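import Literature.AlgebraicGeometry.Modules.TensorSheafHom
import HarnessLib

/-!
# `L ⊗ E ≅ 𝓗om(L^∨, E)` for `L` finite locally free and `E` arbitrary (Hartshorne II Ex. 5.1 (b))

Layer `Literature/AlgebraicGeometry/Modules`, namespace `Literature.AlgebraicGeometry.Modules`.
Sequel to `Modules/TensorSheafHom` (the comparison `θ : L ⊗ E ⟶ 𝓗om(L^∨, E)`, `l ⊗ s ↦ (λ ↦ λ(l) s)`,
for all `L`, `E`). THEOREMS plus two plumbing definitions (`halfCoeff`, `halfFrameSum`); no named
fact, no instance, no notation.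

* §1 **Sections of `L ⊗ E` below a frame neighbourhood of `L`, for an ARBITRARY `E`.** For a
  trivialisation `e : 𝒪^I ≅ L|_W` (`I` finite) and `V ⊆ W`, every element of
  `L(V) ⊗_{𝒪(V)} E(V)` is `∑_i b_i|_V ⊗ s_i` for a unique family `s : I → E(V)` (`halfCoeff`,
  `halfFrameSum`, `halfCoeff_halfFrameSum`, `halfFrameSum_halfCoeff`: the identity
  `𝒪^I ⊗ E = E^I` on sections); hence below `W` the presheaf tensor product `U ↦ L(U) ⊗ E(U)` is
  already a sheaf (its coefficient families live in the sheaf `E`: `halfFrame_sep`, `halfFrame_glue`)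
  and the sheafification unit `L(V) ⊗ E(V) → (L ⊗ E)(V)` is bijective
  (`tensorUnitHom_app_bijective_of_trivialisation`; the one-sided analogue of
  `TensorProductLocallyFree.tensorUnitHom_app_bijective`, which needs frames of BOTH factors).
* §2 **`θ` is an isomorphism for `L` finite locally free** (`isIso_tensorSheafHomDual`,
  `tensorSheafHomDualIso : L ⊗ E ≅ 𝓗om(L^∨, E)`): below a frame neighbourhood, `θ` sends
  `∑ b_i| ⊗ s_i` to `∑ (λ ↦ λ(b_i|) s_i)`, whose value on the dual basis section `λ_j|` is `s_j`
  (`appLE_twistSum_dualBasisSection`) — this inverts `θ` on sections (`tensorSheafHomDual_app_bijective`),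
  and isomorphisms of `𝒪_X`-modules are local (`PushforwardTransport.isIso_of_nhds_bijective`).
  Hartshorne II Ex. 5.1 (b): "`𝓗om(𝓔, 𝓕) ≅ 𝓔^∨ ⊗ 𝓕` for `𝓔` locally free of finite rank", in the form
  `𝓔^∨∨ ⊗ 𝓕 → 𝓗om(𝓔^∨, 𝓕)` with `𝓔^∨∨` replaced by `𝓔`.
* §3 the natural isomorphism of endofunctors `L ⊗ – ≅ 𝓗om(L^∨, –)` for `L` finite locally free
  (`tensorSheafHomDualNatIso`).

## References

* R. Hartshorne, *Algebraic Geometry*, GTM 52 (1977), II Ex. 5.1 (b) (p. 123). [Hartshorne1977]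
* The Stacks Project, Tag 01CA (tensor product: sheafification of `U ↦ 𝓕(U) ⊗ 𝓖(U)`), Tag 01CM.
  [StacksProject]
-/

noncomputable section

-- `TopCat.Presheaf`/`Scheme.Modules` are not reducible (as in Mathlib's `AlgebraicGeometry/Modules/Sheaf.lean`).
set_option backward.isDefEq.respectTransparency false

open CategoryTheory AlgebraicGeometry Opposite TopologicalSpace MonoidalCategory
open Literature.AlgebraicGeometry.Motives
open Literature.AlgebraicGeometry.FormalGeometry.WittGrothendieckExistence.FormalVectorBundlesAlgebraize
open scoped TensorProduct

universe u

namespace Literature.AlgebraicGeometry.Modules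

variable {X : Scheme.{u}}

/-! ### §1 Sections of `L ⊗ E` below a frame neighbourhood of `L` -/

section HalfFrame

variable {L : X.Modules} (E : X.Modules) {W V V' : X.Opens} {I : Type u}
  (e : SheafOfModules.free I ≅ L.over W)

/-- The `𝒪(V)`-bilinear map `(l, s) ↦ (λ_i(l) • s)_i`, `L(V) × E(V) → E(V)^I` (coordinates of `l` in
the frame `e` restricted to `V`). [cite: Hartshorne1977, II.5 p. 109 (free sheaves) and II Ex. 5.1 (b)] -/
def halfCoeffBilin (hV : V ≤ W) : secMod L V →ₗ[secRing X V] secMod E V →ₗ[secRing X V] (I → secMod E V) :=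
  LinearMap.mk₂ (secRing X V) (fun l s i => (coord e (homOfLE hV) l i : Γ(X, V)) • s)
    (fun l l' s => funext fun i => by rw [Pi.add_apply, coord_add, add_smul])
    (fun a l s => funext fun i => by rw [Pi.smul_apply, coord_smul, mul_smul])
    (fun l s s' => funext fun i => by rw [Pi.add_apply, smul_add])
    (fun a l s => funext fun i => by
      change (coord e (homOfLE hV) l i : Γ(X, V)) • ((a : Γ(X, V)) • s) = (a : Γ(X, V)) • ((coord e (homOfLE hV) l i : Γ(X, V)) • s)
      rw [smul_smul, smul_smul, mul_comm])

/-- **Coefficient extraction** `L(V) ⊗_{𝒪(V)} E(V) → E(V)^I`, `l ⊗ s ↦ (λ_i(l) • s)_i`.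
[cite: Hartshorne1977, II.5 p. 109 (free sheaves) and II Ex. 5.1 (b)] -/
def halfCoeff (hV : V ≤ W) : TSec L E V →ₗ[secRing X V] (I → secMod E V) :=
  TensorProduct.lift (halfCoeffBilin E e hV)

/-- Values on pure tensors. [cite: Hartshorne1977, II Ex. 5.1 (b)] -/
theorem halfCoeff_tmul (hV : V ≤ W) (l : secMod L V) (s : secMod E V) (i : I) :
    halfCoeff E e hV (l ⊗ₜ s) i = (coord e (homOfLE hV) l i : Γ(X, V)) • s := by
  rw [halfCoeff, TensorProduct.lift.tmul]; rfl

/-- **Naturality of the coefficients**: `coeff(t|_{V'}) = coeff(t)|_{V'}`. [cite: Hartshorne1977, II Ex. 5.1 (b)] -/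
theorem halfCoeff_resT (hV : V ≤ W) (hV' : V' ≤ V) (t : TSec L E V) (i : I) :
    halfCoeff E e (hV'.trans hV) (resT L E hV' t) i = res E hV' (halfCoeff E e hV t i) := by
  induction t using TensorProduct.induction_on with
  | zero =>
    rw [show resT L E hV' (0 : TSec L E V) = 0 from map_zero _, map_zero, Pi.zero_apply, map_zero,
      Pi.zero_apply]
    exact (map_zero (ConcreteCategory.hom (E.presheaf.map (homOfLE hV').op))).symm
  | tmul l s =>
    rw [resT_tmul, halfCoeff_tmul, halfCoeff_tmul]
    have hc := coord_map e (homOfLE hV) (homOfLE hV') l i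
    rw [Subsingleton.elim (homOfLE hV' ≫ homOfLE hV) (homOfLE (hV'.trans hV))] at hc
    change (coord e (homOfLE (hV'.trans hV)) (L.presheaf.map (homOfLE hV').op l) i : Γ(X, V')) •
      E.presheaf.map (homOfLE hV').op s = E.presheaf.map (homOfLE hV').op ((coord e (homOfLE hV) l i : Γ(X, V)) • s)
    rw [hc]
    exact (Scheme.Modules.map_smul E (homOfLE hV') (coord e (homOfLE hV) l i) s).symm
  | add t t' ht ht' =>
    rw [show resT L E hV' (t + t') = resT L E hV' t + resT L E hV' t' from map_add _ t t', map_add,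
      Pi.add_apply, ht, ht', map_add, Pi.add_apply]
    exact (map_add (ConcreteCategory.hom (E.presheaf.map (homOfLE hV').op)) _ _).symm

variable [Fintype I]

/-- **The section `∑_i b_i|_V ⊗ s_i`** of `L(V) ⊗ E(V)` with coefficient family `s : I → E(V)`.
[cite: Hartshorne1977, II Ex. 5.1 (b)] -/
def halfFrameSum (hV : V ≤ W) (s : I → secMod E V) : TSec L E V :=
  ∑ i, res L hV (basisSection e i) ⊗ₜ[secRing X V] s i

/-- `halfFrameSum` is additive. [cite: Hartshorne1977, II Ex. 5.1 (b)] -/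
theorem halfFrameSum_add (hV : V ≤ W) (s s' : I → secMod E V) :
    halfFrameSum E e hV (s + s') = halfFrameSum E e hV s + halfFrameSum E e hV s' := by
  simp only [halfFrameSum, Pi.add_apply, TensorProduct.tmul_add, Finset.sum_add_distrib]

/-- **The coefficients of `∑_i b_i| ⊗ s_i` are the `s_i`** (`λ_i(b_j|) = δ_{ij}`).
[cite: Hartshorne1977, II Ex. 5.1 (b)] -/
theorem halfCoeff_halfFrameSum (hV : V ≤ W) (s : I → secMod E V) :
    halfCoeff E e hV (halfFrameSum E e hV s) = s := by
  classical
  funext i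
  rw [halfFrameSum, map_sum, Finset.sum_apply]
  simp_rw [halfCoeff_tmul, coord_map_basisSection, ite_smul, one_smul, zero_smul, Finset.sum_ite_eq',
    Finset.mem_univ, if_true]

/-- **Every section of `L(V) ⊗ E(V)` is `∑_i b_i| ⊗ (its coefficients)`** (expand `l = ∑ λ_i(l) b_i|` in
each pure tensor `l ⊗ s`). [cite: Hartshorne1977, II Ex. 5.1 (b)] -/
theorem halfFrameSum_halfCoeff (hV : V ≤ W) (t : TSec L E V) :
    halfFrameSum E e hV (halfCoeff E e hV t) = t := by
  induction t using TensorProduct.induction_on with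
  | zero =>
    rw [map_zero, halfFrameSum]
    exact Finset.sum_eq_zero fun i _ => by rw [Pi.zero_apply, TensorProduct.tmul_zero]
  | tmul l s =>
    conv_rhs => rw [eq_sum_coord_smul e (homOfLE hV) l, TensorProduct.sum_tmul]
    rw [halfFrameSum]
    haveI : TensorProduct.CompatibleSMul (secRing X V) Γ(X, V) (secMod L V) (secMod E V) :=
      inferInstanceAs (TensorProduct.CompatibleSMul (secRing X V) (secRing X V) (secMod L V) (secMod E V))
    refine Finset.sum_congr rfl fun i _ => ?_
    rw [halfCoeff_tmul, TensorProduct.smul_tmul]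
  | add t t' ht ht' => rw [map_add, halfFrameSum_add, ht, ht']

/-- Restriction of `∑_i b_i| ⊗ s_i`: the coefficient family restricts. [cite: Hartshorne1977, II Ex. 5.1 (b)] -/
theorem resT_halfFrameSum (hV : V ≤ W) (hV' : V' ≤ V) (s : I → secMod E V) :
    resT L E hV' (halfFrameSum E e hV s) = halfFrameSum E e (hV'.trans hV) fun i => res E hV' (s i) := by
  rw [halfFrameSum, halfFrameSum, resT_sum]
  refine Finset.sum_congr rfl fun i _ => ?_
  rw [resT_tmul, res_res]

include e in
/-- **Below a frame neighbourhood of `L` the presheaf `U ↦ L(U) ⊗ E(U)` is separated**: a section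
vanishing locally vanishes (its coefficients are sections of the sheaf `E` vanishing locally).
[cite: StacksProject, Tag 01CA] -/
theorem halfFrame_sep (U : X.Opens) (hU : U ≤ W) (t : TSec L E U)
    (h : ∀ x ∈ U, ∃ U' : X.Opens, x ∈ U' ∧ ∃ i : U' ≤ U, resT L E i t = 0) : t = 0 := by
  rw [← halfFrameSum_halfCoeff E e hU t]
  suffices hz : halfCoeff E e hU t = 0 by
    rw [hz, halfFrameSum]
    simp only [Pi.zero_apply, TensorProduct.tmul_zero, Finset.sum_const_zero]
  funext i
  choose U' hxU' iU'U hU' using h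
  refine TopCat.Sheaf.eq_of_locally_eq' ((SheafOfModules.toSheaf _).obj E) (fun x : U => U' x.1 x.2) U
    (fun x => homOfLE (iU'U x.1 x.2)) (fun x hx => Opens.mem_iSup.2 ⟨⟨x, hx⟩, hxU' x hx⟩) _ _ fun x => ?_
  change res E (iU'U x.1 x.2) (halfCoeff E e hU t i) = res E (iU'U x.1 x.2) ((0 : I → secMod E U) i)
  rw [← halfCoeff_resT, hU' x.1 x.2, map_zero, Pi.zero_apply, Pi.zero_apply]
  exact (map_zero (ConcreteCategory.hom (E.presheaf.map (homOfLE (iU'U x.1 x.2)).op))).symm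

include e in
/-- **Below a frame neighbourhood of `L` the presheaf `U ↦ L(U) ⊗ E(U)` satisfies gluing**: glue the
coefficient families in the sheaf `E`. [cite: StacksProject, Tag 01CA] -/
theorem halfFrame_glue (U : X.Opens) (hU : U ≤ W) (ι' : Type u) (O : ι' → X.Opens) (iOU : ∀ j, O j ≤ U)
    (hcov : U ≤ iSup O) (s : ∀ j, TSec L E (O j))
    (hs : ∀ j j', resT L E (inf_le_left : O j ⊓ O j' ≤ O j) (s j) =
      resT L E (inf_le_right : O j ⊓ O j' ≤ O j') (s j')) :
    ∃ t : TSec L E U, ∀ j, resT L E (iOU j) t = s j := by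
  -- the coefficient families of the local sections are compatible, hence glue in `E`
  have ha : ∀ i, TopCat.Presheaf.IsCompatible ((SheafOfModules.toSheaf X.ringCatSheaf).obj E).obj O
      fun j => halfCoeff E e ((iOU j).trans hU) (s j) i := by
    intro i j j'
    change res E inf_le_left (halfCoeff E e _ (s j) i) = res E inf_le_right (halfCoeff E e _ (s j') i)
    rw [← halfCoeff_resT, ← halfCoeff_resT]
    exact congrArg (fun q => halfCoeff E e ((inf_le_left.trans (iOU j)).trans hU) q i)
      (hs j j')
  choose g hg _ using fun i => TopCat.Sheaf.existsUnique_gluing' ((SheafOfModules.toSheaf _).obj E) O U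
    (fun j => homOfLE (iOU j)) hcov (fun j => halfCoeff E e ((iOU j).trans hU) (s j) i) (ha i)
  refine ⟨halfFrameSum E e hU g, fun j => ?_⟩
  rw [resT_halfFrameSum]
  have hg' : (fun i => res E (iOU j) (g i)) = halfCoeff E e ((iOU j).trans hU) (s j) :=
    funext fun i => hg i j
  rw [hg']
  exact halfFrameSum_halfCoeff E e _ (s j)

include e in
/-- **Below a frame neighbourhood of `L` the unit `L(V) ⊗ E(V) → (L ⊗ E)(V)` is bijective**, for an
ARBITRARY `E` (`TensorProductLocallyFree.toSheafify_app_bijective_of_sheaf_below` with §1's separation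
and gluing). [cite: StacksProject, Tag 01CA] -/
theorem tensorUnitHom_app_bijective_of_trivialisation (V : X.Opens) (hV : V ≤ W) :
    Function.Bijective ((tensorUnitHom L E).app (op V)) := by
  change Function.Bijective
    ((toSheafify (Opens.grothendieckTopology X) (tensorPresheaf L E).presheaf).app (op V))
  exact toSheafify_app_bijective_of_sheaf_below (tensorPresheaf L E).presheaf W
    (fun U hU t h => halfFrame_sep E e U hU t h)
    (fun U hU ι' O iOU hcov s hs => halfFrame_glue E e U hU ι' O iOU hcov s hs) V hV

/-- Hence every section of `L ⊗ E` over `V ⊆ W` is `η_V(∑_i b_i| ⊗ s_i)` for a unique coefficient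
family `s : I → E(V)`. [cite: Hartshorne1977, II Ex. 5.1 (b)] -/
theorem tensorUnitHom_halfFrameSum_bijective (hV : V ≤ W) :
    Function.Bijective fun s : I → secMod E V =>
      ((tensorUnitHom L E).app (op V) (halfFrameSum E e hV s) : Γ(tensorObj L E, V)) := by
  refine (tensorUnitHom_app_bijective_of_trivialisation E e V hV).comp ⟨fun s s' h => ?_, fun t => ?_⟩
  · have h' := congrArg (halfCoeff E e hV) h
    rwa [halfCoeff_halfFrameSum, halfCoeff_halfFrameSum] at h'
  · exact ⟨halfCoeff E e hV t, halfFrameSum_halfCoeff E e hV t⟩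

end HalfFrame

/-! ### §2 `θ : L ⊗ E ⟶ 𝓗om(L^∨, E)` is an isomorphism for `L` finite locally free -/

section Iso

variable {L : X.Modules} (E : X.Modules) {W V : X.Opens} {I : Type u} [Fintype I]
  (e : SheafOfModules.free I ≅ L.over W)

/-- The morphism `∑_i (λ ↦ λ(b_i|) • s_i) : L^∨|_V ⟶ E|_V` — the image under `θ` of `∑ b_i| ⊗ s_i`.
[cite: Hartshorne1977, II Ex. 5.1 (b)] -/
def twistSum (hV : V ≤ W) (s : I → secMod E V) : (dual L).over V ⟶ E.over V :=
  ∑ i, twistHomOfSections L E V (res L hV (basisSection e i)) (s i)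

/-- **`θ(η(∑ b_i| ⊗ s_i)) = ∑ (λ ↦ λ(b_i|) • s_i)`.** [cite: Hartshorne1977, II Ex. 5.1 (b)] -/
theorem tensorSheafHomDual_app_halfFrameSum (hV : V ≤ W) (s : I → secMod E V) :
    (tensorSheafHomDual L E).app V ((tensorUnitHom L E).app (op V) (halfFrameSum E e hV s)) =
      (twistSum E e hV s : secMod (sheafHom (dual L) E) V) := by
  rw [halfFrameSum, tensorUnitHom_app_sum, map_sum, twistSum]
  refine Finset.sum_congr rfl fun i _ => ?_
  exact tensorSheafHomDual_app_tmulSection L E V _ (s i)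

/-- **The value of `∑_i (λ ↦ λ(b_i|) • s_i)` on the dual basis section `λ_j|_V` is `s_j`.**
[cite: Hartshorne1977, II Ex. 5.1 (b)] -/
theorem appLE_twistSum_dualBasisSection (hV : V ≤ W) (s : I → secMod E V) (j : I) :
    appLE (twistSum E e hV s) (𝟙 V) ((dual L).presheaf.map (homOfLE hV).op (dualBasisSection e j)) = s j := by
  classical
  rw [twistSum, appLE_sum]
  have h : ∀ i, appLE (twistHomOfSections L E V (res L hV (basisSection e i)) (s i)) (𝟙 V)
      ((dual L).presheaf.map (homOfLE hV).op (dualBasisSection e j)) = (if i = j then (1 : Γ(X, V)) else 0) • s i := by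
    intro i
    change appLE (twistHomOfSections L E V (res L hV (basisSection e i)) (s i)) (𝟙 V)
      ((restrictHom (homOfLE hV) (dualBasis e j) : L.over V ⟶ (unitModule X).over V) : Γ(dual L, V)) = _
    rw [appLE_twistHomOfSections, appLE_restrictHom, presheaf_map_id, presheaf_map_id, Category.id_comp]
    change coord e (homOfLE hV) (res L hV (basisSection e i)) j • s i = _
    rw [coord_map_basisSection]
  simp_rw [h, ite_smul, one_smul, zero_smul, Finset.sum_ite_eq', Finset.mem_univ, if_true]

include e in
/-- **`θ_V` is bijective below a frame neighbourhood of `L`.** Injective: a section of `L ⊗ E` over `V`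
is `η(∑ b_i| ⊗ s_i)` and `θ` of it recovers `s_j` on `λ_j|`; surjective: `φ = θ(η(∑ b_i| ⊗ φ(λ_i|)))`,
two morphisms out of `L^∨|_V` agreeing on the dual basis being equal. [cite: Hartshorne1977, II Ex. 5.1 (b)] -/
theorem tensorSheafHomDual_app_bijective (hV : V ≤ W) :
    Function.Bijective ((tensorSheafHomDual L E).app V) := by
  have hη := tensorUnitHom_halfFrameSum_bijective E e hV
  refine ⟨fun t t' h => ?_, fun φ => ?_⟩
  · obtain ⟨s, rfl⟩ := hη.2 t
    obtain ⟨s', rfl⟩ := hη.2 t'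
    change (tensorSheafHomDual L E).app V ((tensorUnitHom L E).app (op V) (halfFrameSum E e hV s)) =
      (tensorSheafHomDual L E).app V ((tensorUnitHom L E).app (op V) (halfFrameSum E e hV s')) at h
    rw [tensorSheafHomDual_app_halfFrameSum, tensorSheafHomDual_app_halfFrameSum] at h
    have hs : s = s' := funext fun j => by
      rw [← appLE_twistSum_dualBasisSection E e hV s j, ← appLE_twistSum_dualBasisSection E e hV s' j]
      exact congrArg (fun ψ : (dual L).over V ⟶ E.over V =>
        appLE ψ (𝟙 V) ((dual L).presheaf.map (homOfLE hV).op (dualBasisSection e j))) h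
    rw [hs]
  · let φ' : (dual L).over V ⟶ E.over V := φ
    refine ⟨(tensorUnitHom L E).app (op V)
      (halfFrameSum E e hV fun j => appLE φ' (𝟙 V) ((dual L).presheaf.map (homOfLE hV).op (dualBasisSection e j))), ?_⟩
    change ((tensorSheafHomDual L E).app V _ : secMod (sheafHom (dual L) E) V) = (φ' : secMod (sheafHom (dual L) E) V)
    rw [tensorSheafHomDual_app_halfFrameSum]
    change twistSum E e hV _ = φ'
    refine hom_ext_of_basisSection
      (dualFrame (SheafOfModules.restrictTrivialisation (R := X.ringCatSheaf) (homOfLE hV) e)) fun j => ?_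
    rw [basisSection_dualFrame, ← map_dualBasisSection, appLE_twistSum_dualBasisSection]

variable (L)

/-- **`θ : L ⊗ E ⟶ 𝓗om(L^∨, E)` is an isomorphism for `L` finite locally free** (and `E` arbitrary):
Hartshorne II Ex. 5.1 (b), "`𝓗om(𝓔, 𝓕) ≅ 𝓔^∨ ⊗ 𝓕` for `𝓔` locally free of finite rank" (with
`𝓔 := L^∨`, `𝓔^∨ = L^∨∨` replaced by `L`). Isomorphisms of `𝒪_X`-modules are local and `θ` is bijective
on sections below every frame neighbourhood of `L`. [cite: Hartshorne1977, II Ex. 5.1 (b) (p. 123)] -/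
theorem isIso_tensorSheafHomDual (hL : IsFiniteLocallyFree L) : IsIso (tensorSheafHomDual L E) := by
  refine PushforwardTransport.isIso_of_nhds_bijective _ fun x => ?_
  obtain ⟨W, hxW, I, hI, ⟨e⟩⟩ := hL x
  haveI := Fintype.ofFinite I
  exact ⟨W, hxW, fun V hV => tensorSheafHomDual_app_bijective E e hV⟩

/-- **`L ⊗ E ≅ 𝓗om(L^∨, E)`** for `L` finite locally free. [cite: Hartshorne1977, II Ex. 5.1 (b) (p. 123)] -/
def tensorSheafHomDualIso (hL : IsFiniteLocallyFree L) : tensorObj L E ≅ sheafHom (dual L) E :=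
  haveI := isIso_tensorSheafHomDual L E hL
  asIso (tensorSheafHomDual L E)

/-- Unfolding. [cite: Hartshorne1977, II Ex. 5.1 (b) (p. 123)] -/
@[simp]
theorem tensorSheafHomDualIso_hom (hL : IsFiniteLocallyFree L) :
    (tensorSheafHomDualIso L E hL).hom = tensorSheafHomDual L E := rfl

/-- Section formula for the isomorphism: `l ⊗ s ↦ (λ ↦ λ(l) • s)`. [cite: Hartshorne1977, II Ex. 5.1 (b) (p. 123)] -/
theorem tensorSheafHomDualIso_hom_app_tmulSection (hL : IsFiniteLocallyFree L) (U : X.Opens)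
    (l : secMod L U) (s : secMod E U) :
    (tensorSheafHomDualIso L E hL).hom.app U (tmulSection L E U l s) =
      (twistHomOfSections L E U l s : secMod (sheafHom (dual L) E) U) :=
  tensorSheafHomDual_app_tmulSection L E U l s

end Iso

/-! ### §3 The natural isomorphism `L ⊗ – ≅ 𝓗om(L^∨, –)` for `L` finite locally free -/

section NatIso

variable (L : X.Modules)

/-- The natural transformation `θ : L ⊗ – ⟶ 𝓗om(L^∨, –)` is an isomorphism for `L` finite locally free.
[cite: Hartshorne1977, II Ex. 5.1 (b) (p. 123)] -/
theorem isIso_tensorSheafHomDualNatTrans (hL : IsFiniteLocallyFree L) :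
    IsIso (tensorSheafHomDualNatTrans L) := by
  haveI : ∀ E : X.Modules, IsIso ((tensorSheafHomDualNatTrans L).app E) := fun E =>
    isIso_tensorSheafHomDual L E hL
  exact NatIso.isIso_of_isIso_app _

/-- **`L ⊗ – ≅ 𝓗om(L^∨, –)`** as endofunctors of `Mod(𝒪_X)`, for `L` finite locally free
(`Modules.tensorBifunctor`, `Modules.sheafHomFunctor`). [cite: Hartshorne1977, II Ex. 5.1 (b) (p. 123)] -/
def tensorSheafHomDualNatIso (hL : IsFiniteLocallyFree L) :
    (tensorBifunctor X).obj L ≅ sheafHomFunctor (dual L) :=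
  haveI := isIso_tensorSheafHomDualNatTrans L hL
  asIso (tensorSheafHomDualNatTrans L)

/-- Components of the natural isomorphism. [cite: Hartshorne1977, II Ex. 5.1 (b) (p. 123)] -/
@[simp]
theorem tensorSheafHomDualNatIso_hom_app (hL : IsFiniteLocallyFree L) (E : X.Modules) :
    (tensorSheafHomDualNatIso L hL).hom.app E = tensorSheafHomDual L E := rfl

end NatIso

end Literature.AlgebraicGeometry.Modules

end
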